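import Literature.Probability.RandomPlanarGeometry.HexSAWSurfaceWallRenewalThirdExact
import Literature.Probability.RandomPlanarGeometry.HexSAWSurfaceFourthOrderLower
import HarnessLib

/-!
# The three renewal blocks of length ten: `N₅₁ = 3`, `Λ₁₀(y) = 3y`, `f₅(y) = 3y/β(y)¹⁰`, and the fourth order from below

Brick-wall (honeycomb) self-avoiding walks at an adsorbing surface, positive wall bridges and their wall-renewal blocks
(`pwb n`, `ipwb n`, `IPWB`, `pwbLaw`, `pwbMean` of `HexSAWSurfaceWallRenewal`; `β = wallRate`).  The companion module
`HexSAWSurfaceWallRenewalThirdExact` proved, by the order-three analytic census, that EVERY irreducible positive wall bridge of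
length ten has exactly one surface visit (`visits_eq_one_of_mem_ipwb_ten`), so that `Λ₁₀(y) = N₅₁·y` and `f₅(y) = N₅₁·y/β(y)¹⁰`
with `N₅₁ = #(ipwb 10)` left symbolic.  Here the count is CLOSED: `N₅₁ = 3`.

* §1 The three seeds of `HexSAWSurfaceFourthOrderLower` — the long flat excursion `Ten.aw = (0,0)(1,0)(1,−1)(2,−1)…(7,−1)(7,0)(8,0)`,
  the terrace `Ten.bw = (0,0)(1,0)(1,−1)(2,−1)(2,−2)(3,−2)(4,−2)(4,−1)(5,−1)(5,0)(6,0)` and the right hook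
  `Ten.cw = (0,0)(1,0)(1,−1)(2,−1)(2,−2)(3,−2)(4,−2)(4,−1)(3,−1)(3,0)(4,0)` — are irreducible positive wall bridges
  (`mem_pwb_of_facts`, `mem_ipwb_of_facts`, `aw_mem_ipwb`, … — length and walk kept symbolic), so `3 ≤ #(ipwb 10)` (`three_le_card_ipwb_ten`).
* §2 ★★ **Classification** `one_visit_pwb_ten_eq`: a one-visit positive wall bridge of length ten IS one of the three seeds.  The
  proof is a step-by-step case analysis on the brick-wall lattice (horizontal bonds everywhere, the vertical bond above `(a, b)` iff
  `a + b` is even — `Arm.step_cases`), organised around the parity invariant `X_i + Y_i ≡ i (mod 2)` (`parity_apply`): an UP step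
  starts at an even time and a DOWN step at an odd time, so the last step runs along the row, the step before it is up
  (`Y₉ = 0`, `Y₈ = −1`), time `7` is at height `−1`, and the first three steps are `(1,0)(1,−1)(2,−1)`; the middle `ω₄ ω₅ ω₆` then
  has exactly three completions.
* §3 ★★★ **`card_ipwb_ten_eq_three : #(ipwb 10) = 3`** (`N₅₁ = 3`), `card_oneVisit_pwb_ten_eq_three`, ★★ `IPWB_ten_eq : Λ₁₀(y) = 3y`,
  ★★ `pwbLaw_five_eq : f₅(y) = 3y/β(y)¹⁰` — with `f₁ = y/β²`, `f₂ = 0`, `f₃ = y/β⁶`, `f₄ = y/β⁸` the renewal law is now explicit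
  through half-length five.
* §4 ★★ The FOURTH order of the renewal mean from below: `twelve_mul_div_le : 12y/β¹⁰ ≤ m(y) − 1 − 2y/β⁶ − 3y/β⁸` (`y > μ⁴`),
  `tendsto_pow_five_div_wallRate_pow_ten : y⁵/β¹⁰ → 1`, ★★ `eventually_le_pow_four_mul_pwbMean : ∀ ε > 0, eventually
  12 − ε ≤ y⁴ (m(y) − 1 − 2y/β⁶ − 3y/β⁸)` (so `liminf ≥ 12`), `twelve_le_of_tendsto_pow_four_mul`.

SOURCES.  The objects: positive (wall) bridges and the renewal / irreducible-bridge structure [MadrasSlade1993, Section 1.2,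
Definition 1.2.4; Section 4.2, Definition 4.2.1, (4.2.2)–(4.2.5), Theorem 4.2.2 (pp. 91–92)], [Kesten1963SAW, Section 4]; renewal
sequences [Feller1968, XIII.3]; exact enumeration of short surface walks on the brickwork honeycomb lattice [EntingJensen2009,
Section 7.4.2, Fig. 7.10], [JansevanRensburg2000, Section 3.3.2, Lemma 3.20 (most-popular-class / finite enumeration arguments)];
the adsorption model and its fugacity `y` [BeatonBousquetMelouDeGierDuminilCopinGuttmann2014, Section 3.1, Proposition 5];
`μ = √(2+√2)` [DuminilCopinSmirnov2012, Theorem 1].  The printed sources contain the definitions and the general renewal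
identities; the classification `N₅₁ = 3` and the fourth-order lower bound `12` for this model are computed here (lane results, not
quotations).

NOT CLAIMED: the number `N₆₂` of two-visit blocks of length twelve (brute force: `1`), hence not the fourth-order LIMIT (conjecturally
`lim y⁴ (m − 1 − 2y/β⁶ − 3y/β⁸) = 4·N₅₁ + 5·N₆₂ = 17`); nothing for `y ≤ μ⁴`; no numerics.
-/

namespace Literature.Probability.RandomPlanarGeometry.SAW.HexBW.Wall

open Finset Filter Function
open Literature.Probability.LatticeModels
open _root_.Topology Asymptotics

variable {y : ℝ} {n : ℕ} {ω : ℕ → Site 2}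

/-! ### §1  The three seeds of length ten are irreducible positive wall bridges -/

/-- A table walk satisfying `Tab.Facts` (left-proper: `X_i ≥ 1` for `1 ≤ i ≤ L`, and `X_i ≤ X_L`) is a POSITIVE wall bridge.  The
length `m = L` and the walk `w = Tab.walk L X Y` are kept symbolic, so that no closed `pwb 10` is ever unfolded by the elaborator.
[cite: MadrasSlade1993, Section 1.2, Definition 1.2.4] [cite: EntingJensen2009, Section 7.4.2, Fig. 7.10] -/
theorem mem_pwb_of_facts {L m : ℕ} {X Y : ℕ → ℤ} {w : ℕ → Site 2} (hw : w = Tab.walk L X Y) (h : Tab.Facts L X Y) (hm : m = L) :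
    w ∈ pwb m := by
  obtain ⟨h0, hfr, hbw, hinj, hH, harch, hwb, -⟩ := Tab.walk_components h
  obtain ⟨-, -, -, hmono, hX0, -, -, -, hleft⟩ := h
  rw [mem_pwb, mem_wbr, mem_archs, mem_hpw, mem_saws_iff]
  subst hm hw
  refine ⟨⟨⟨⟨⟨h0, hfr, hbw, hinj⟩, hH⟩, harch⟩, hwb⟩, fun i h1 h2 => ?_⟩
  have a := hleft i h2 h1
  have b := (hmono i h2).2
  rw [Tab.walk_apply_of_le h2, Tab.walk_apply_of_le (Nat.zero_le _), Tab.walk_apply_of_le le_rfl, Arm.pt_apply_zero,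
    Arm.pt_apply_zero, Arm.pt_apply_zero, hX0]
  constructor <;> omega

/-- A table walk whose heights at the even times in `[1, L)` are nonzero has no wall-renewal time there: it is an IRREDUCIBLE
positive wall bridge (length and walk symbolic). [cite: MadrasSlade1993, Section 4.2, Definition 4.2.1] [cite: Kesten1963SAW, Section 4] -/
theorem mem_ipwb_of_facts {L m : ℕ} {X Y : ℕ → ℤ} {w : ℕ → Site 2} (hw : w = Tab.walk L X Y) (h : Tab.Facts L X Y) (hm : m = L)
    (hL : 1 ≤ L) (hdeep : ∀ k < L, 1 ≤ k → k % 2 = 0 → Y k ≠ 0) : w ∈ ipwb m := by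
  rw [mem_ipwb]
  refine ⟨mem_pwb_of_facts hw h hm, by omega, fun k hk1 hk2 hren => hdeep k (by omega) hk1 hren.2.1 ?_⟩
  have hY := hren.2.2
  subst hm hw
  rwa [Tab.walk_apply_of_le hk2.le, Arm.pt_apply_one] at hY

/-- The long flat excursion is below the row at the even times `2, 4, 6, 8` (by `decide`). [cite: EntingJensen2009, Section 7.4.2, Fig. 7.10] -/
theorem Ten.a_deep : ∀ k < 10, 1 ≤ k → k % 2 = 0 → Ten.aY k ≠ 0 := by decide

/-- The terrace is below the row at the even times `2, 4, 6, 8` (by `decide`). [cite: EntingJensen2009, Section 7.4.2, Fig. 7.10] -/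
theorem Ten.b_deep : ∀ k < 10, 1 ≤ k → k % 2 = 0 → Ten.bY k ≠ 0 := by decide

/-- The right hook is below the row at the even times `2, 4, 6, 8` (by `decide`). [cite: EntingJensen2009, Section 7.4.2, Fig. 7.10] -/
theorem Ten.c_deep : ∀ k < 10, 1 ≤ k → k % 2 = 0 → Ten.cY k ≠ 0 := by decide

/-- ★ The long flat excursion `Ten.aw` is an irreducible positive wall bridge of length ten (symbolic length).
[cite: MadrasSlade1993, Section 4.2, Definition 4.2.1] [cite: EntingJensen2009, Section 7.4.2, Fig. 7.10] -/
theorem aw_mem_ipwb {m : ℕ} (hm : m = 10) : Ten.aw ∈ ipwb m :=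
  mem_ipwb_of_facts (w := Ten.aw) rfl Ten.a_facts hm (by norm_num) Ten.a_deep

/-- ★ The terrace `Ten.bw` is an irreducible positive wall bridge of length ten (symbolic length).
[cite: MadrasSlade1993, Section 4.2, Definition 4.2.1] [cite: EntingJensen2009, Section 7.4.2, Fig. 7.10] -/
theorem bw_mem_ipwb {m : ℕ} (hm : m = 10) : Ten.bw ∈ ipwb m :=
  mem_ipwb_of_facts (w := Ten.bw) rfl Ten.b_facts hm (by norm_num) Ten.b_deep

/-- ★ The right hook `Ten.cw` is an irreducible positive wall bridge of length ten (symbolic length).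
[cite: MadrasSlade1993, Section 4.2, Definition 4.2.1] [cite: EntingJensen2009, Section 7.4.2, Fig. 7.10] -/
theorem cw_mem_ipwb {m : ℕ} (hm : m = 10) : Ten.cw ∈ ipwb m :=
  mem_ipwb_of_facts (w := Ten.cw) rfl Ten.c_facts hm (by norm_num) Ten.c_deep

open Classical in
/-- ★ **`3 ≤ N₅₁ = #(ipwb 10)`**: the three seeds are distinct irreducible positive wall bridges of length ten (symbolic length).
[cite: MadrasSlade1993, Section 4.2, Definition 4.2.1, (4.2.2)] [cite: JansevanRensburg2000, Section 3.3.2, Lemma 3.20] [cite: EntingJensen2009, Section 7.4.2, Fig. 7.10] -/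
theorem three_le_card_ipwb_ten {m : ℕ} (hm : m = 10) : 3 ≤ #(ipwb m) := by
  obtain ⟨hab, hac, hbc⟩ := Ten.aw_ne_bw_ne_cw
  have hsub : ({Ten.aw, Ten.bw, Ten.cw} : Finset (ℕ → Site 2)) ⊆ ipwb m := by
    intro w hw
    simp only [Finset.mem_insert, Finset.mem_singleton] at hw
    rcases hw with rfl | rfl | rfl
    · exact aw_mem_ipwb hm
    · exact bw_mem_ipwb hm
    · exact cw_mem_ipwb hm
  have hcard : #({Ten.aw, Ten.bw, Ten.cw} : Finset (ℕ → Site 2)) = 3 := by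
    rw [Finset.card_insert_of_notMem, Finset.card_insert_of_notMem, Finset.card_singleton]
    · simpa using hbc
    · simp [hab, hac]
  exact hcard ▸ Finset.card_le_card hsub

/-! ### §2  Classification of the one-visit positive wall bridges of length ten -/

/-- ★★ **A one-visit positive wall bridge of length ten is the long flat excursion, the terrace or the right hook** (symbolic length
`m = 10`; no hypothesis with a closed index is introduced).  Brick-wall steps (`Arm.step_cases`) and the parity invariant
(`parity_apply`): the last step is along the row and the one before it is UP (`Y₉ = 0`, `Y₈ = −1`, `X₈ = X₉ = X₁₀ − 1`), time `7` is at
height `−1`, the start is `(1,0)(1,−1)(2,−1)`; then `ω₄ = (3,−1)` forces `(4,−1)(5,−1)(6,−1)(7,−1)` (the long flat excursion) and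
`ω₄ = (2,−2)` forces `(3,−2)(4,−2)(4,−1)` followed by `(5,−1)` (terrace) or `(3,−1)` (right hook).
[cite: EntingJensen2009, Section 7.4.2, Fig. 7.10] [cite: MadrasSlade1993, Section 1.2, Definition 1.2.4] [cite: JansevanRensburg2000, Section 3.3.2, Lemma 3.20] -/
theorem one_visit_pwb_ten_eq {m : ℕ} (hm : m = 10) (hω : ω ∈ pwb m) (hv : visits m ω = 1) :
    ω = Ten.aw ∨ ω = Ten.bw ∨ ω = Ten.cw := by
  obtain ⟨hωw, hbr⟩ := mem_pwb.1 hω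
  obtain ⟨hωa, -⟩ := mem_wbr.1 hωw
  obtain ⟨hωh, -, hend⟩ := mem_archs.1 hωa
  obtain ⟨hωs, hH⟩ := mem_hpw.1 hωh
  obtain ⟨h0, -, hbw, hinj⟩ := mem_saws_iff.1 hωs
  have hsA : Ten.aw ∈ saws m := saws_of_mem_pwb (ipwb_subset (aw_mem_ipwb hm))
  have hsB : Ten.bw ∈ saws m := saws_of_mem_pwb (ipwb_subset (bw_mem_ipwb hm))
  have hsC : Ten.cw ∈ saws m := saws_of_mem_pwb (ipwb_subset (cw_mem_ipwb hm))
  have hne : ∀ a b : ℕ, a ≤ 10 → b ≤ 10 → a ≠ b → ¬ (ω a 0 = ω b 0 ∧ ω a 1 = ω b 1) := by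
    intro a b ha hb hab h
    have := hinj (show a ∈ {i | i ≤ m} by simp only [Set.mem_setOf_eq]; omega)
      (show b ∈ {i | i ≤ m} by simp only [Set.mem_setOf_eq]; omega) ((site_two_eq_iff _ _).2 h)
    exact hab this
  have h00 : ω 0 0 = 0 := by rw [h0]; rfl
  have h01 : ω 0 1 = 0 := by rw [h0]; rfl
  have hend10 : ω 10 1 = 0 := by have h := hend; rwa [hm] at h
  -- positivity and the bridge condition
  have hpos : ∀ i, 1 ≤ i → i ≤ 10 → 0 < ω i 0 := fun i h1 h2 => by
    have h := (hbr i h1 (by omega)).1; rwa [h00] at h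
  have hle10 : ∀ i, 1 ≤ i → i ≤ 10 → ω i 0 ≤ ω 10 0 := fun i h1 h2 => by
    have h := (hbr i h1 (by omega)).2; rwa [hm] at h
  -- one visit: the even times 2, 4, 6, 8 are off the row
  have hv10 : visits 10 ω = 1 := by have h := hv; rwa [hm] at h
  have e : visits 10 ω = (if ω 2 1 = 0 then 1 else 0) + (if ω 4 1 = 0 then 1 else 0) + (if ω 6 1 = 0 then 1 else 0) +
      (if ω 8 1 = 0 then 1 else 0) + (if ω 10 1 = 0 then 1 else 0) := by
    simp [visits]
  rw [hv10, if_pos hend10] at e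
  have hn : ¬ (ω 2 1 = 0) ∧ ¬ (ω 4 1 = 0) ∧ ¬ (ω 6 1 = 0) ∧ ¬ (ω 8 1 = 0) := by
    by_cases h2 : ω 2 1 = 0 <;> by_cases h4 : ω 4 1 = 0 <;> by_cases h6 : ω 6 1 = 0 <;> by_cases h8 : ω 8 1 = 0 <;>
      simp only [h2, h4, h6, h8, if_true, if_false] at e <;> first | exact ⟨h2, h4, h6, h8⟩ | (exfalso; omega)
  obtain ⟨hn2, hn4, hn6, hn8⟩ := hn
  -- parities at times 7 and 9 (odd): no UP step starts there, no DOWN step ends there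
  have hq7 := parity_apply hωs (show 7 ≤ m by omega)
  have hq9 := parity_apply hωs (show 9 ≤ m by omega)
  push_cast at hq7 hq9
  -- time 1: `(1, 0)`
  obtain ⟨hY1, hX1⟩ := surface_next_step hωh (i := 0) (by omega) (by omega) h01
  rw [show 0 + 1 = 1 from rfl] at hY1 hX1
  have hp1 := hpos 1 (by omega) (by omega)
  have hX1' : ω 1 0 = 1 := by omega
  clear hX1
  -- time 2: `(1, −1)` (a row vertex at time 2 would be a visit)
  have hH2 := hH 2 (by omega)
  have s1 := Arm.step_cases (hbw 1 (by omega))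
  rw [show 1 + 1 = 2 from rfl] at s1
  have hX2 : ω 2 0 = 1 ∧ ω 2 1 = -1 := by constructor <;> omega
  clear s1 hH2
  obtain ⟨hX2, hY2⟩ := hX2
  -- time 3: `(2, −1)` (positivity kills `(0,−1)`, injectivity kills `(1,0)`, the bond below `(1,−1)` is absent)
  have s2 := Arm.step_cases (hbw 2 (by omega))
  rw [show 2 + 1 = 3 from rfl] at s2
  have hp3 := hpos 3 (by omega) (by omega)
  have h31 := hne 3 1 (by omega) (by omega) (by omega)
  have hX3 : ω 3 0 = 2 ∧ ω 3 1 = -1 := by constructor <;> omega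
  clear s2 h31 hp3
  obtain ⟨hX3, hY3⟩ := hX3
  -- times 9, 10 (backwards): the last step runs along the row to the right
  have hH9 := hH 9 (by omega)
  have hle9 := hle10 9 (by omega) (by omega)
  have s9 := Arm.step_cases (hbw 9 (by omega))
  rw [show 9 + 1 = 10 from rfl] at s9
  have h9 : ω 9 1 = 0 ∧ ω 10 0 = ω 9 0 + 1 := by constructor <;> omega
  clear s9 hle9 hH9
  obtain ⟨hY9, hX10⟩ := h9
  -- time 8: the step `8 → 9` is UP (along the row would make time 8 a visit; no down step ends at the odd time 9)
  have s8 := Arm.step_cases (hbw 8 (by omega))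
  rw [show 8 + 1 = 9 from rfl] at s8
  have h8 : ω 8 0 = ω 9 0 ∧ ω 8 1 = -1 := by constructor <;> omega
  clear s8
  obtain ⟨hX8, hY8⟩ := h8
  -- time 7: height `−1` (no up step starts at the odd time 7; a down step from the row would box the walk at time 6)
  have hH6 := hH 6 (by omega)
  have h86 := hne 8 6 (by omega) (by omega) (by omega)
  have s7 := Arm.step_cases (hbw 7 (by omega))
  rw [show 7 + 1 = 8 from rfl] at s7
  have s6 := Arm.step_cases (hbw 6 (by omega))
  rw [show 6 + 1 = 7 from rfl] at s6
  have h7 : ω 7 1 = -1 ∧ (ω 7 0 = ω 8 0 + 1 ∨ ω 8 0 = ω 7 0 + 1) := by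
    have a : (ω 7 1 = -1 ∧ (ω 7 0 = ω 8 0 + 1 ∨ ω 8 0 = ω 7 0 + 1)) ∨ (ω 7 1 = 0 ∧ ω 7 0 = ω 8 0) := by
      clear s6 h86 hH6; omega
    rcases a with a | ⟨b, c⟩
    · exact a
    · exfalso; clear s7; omega
  clear s7
  obtain ⟨hY7, hX78⟩ := h7
  -- time 4: `(3, −1)` or `(2, −2)`
  have s3 := Arm.step_cases (hbw 3 (by omega))
  rw [show 3 + 1 = 4 from rfl] at s3
  have h42 := hne 4 2 (by omega) (by omega) (by omega)
  have h4 : (ω 4 0 = 3 ∧ ω 4 1 = -1) ∨ (ω 4 0 = 2 ∧ ω 4 1 = -2) := by clear s6 hX78 h86; omega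
  clear s3 h42
  have s4 := Arm.step_cases (hbw 4 (by omega))
  rw [show 4 + 1 = 5 from rfl] at s4
  have s5 := Arm.step_cases (hbw 5 (by omega))
  rw [show 5 + 1 = 6 from rfl] at s5
  have h53 := hne 5 3 (by omega) (by omega) (by omega)
  have h64 := hne 6 4 (by omega) (by omega) (by omega)
  have h75 := hne 7 5 (by omega) (by omega) (by omega)
  rcases h4 with ⟨hX4, hY4⟩ | ⟨hX4, hY4⟩
  · -- the flat branch `(3,−1)`: time 5 is `(4,−1)` (`(3,0)` is boxed in at time 6), time 6 is `(5,−1)` (`(4,−2)` cannot be back at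
    -- height −1 at time 7), time 7 is `(6,−1)`, time 8 is `(7,−1)`: the long flat excursion
    have h5 : ω 5 0 = 4 ∧ ω 5 1 = -1 := by
      have a : (ω 5 0 = 4 ∧ ω 5 1 = -1) ∨ (ω 5 0 = 3 ∧ ω 5 1 = 0) := by clear s5 s6 h64 h75 hX78 h86; omega
      rcases a with a | ⟨b, c⟩
      · exact a
      · exfalso; clear s4 s6 h53 h75 hX78 h86; omega
    clear s4 h53
    obtain ⟨hX5, hY5⟩ := h5
    have h6 : ω 6 0 = 5 ∧ ω 6 1 = -1 := by
      have a : (ω 6 0 = 5 ∧ ω 6 1 = -1) ∨ (ω 6 0 = 4 ∧ ω 6 1 = -2) := by clear s6 h75 hX78 h86; omega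
      rcases a with a | ⟨b, c⟩
      · exact a
      · exfalso; clear s5 h64 hX78 h86; omega
    clear s5 h64
    obtain ⟨hX6, hY6⟩ := h6
    have hX7 : ω 7 0 = 6 := by clear hX78 h86; omega
    clear s6 h75
    have hX8' : ω 8 0 = 7 := by omega
    have hX9 : ω 9 0 = 7 := by omega
    have hX10' : ω 10 0 = 8 := by omega
    left
    refine Arm.eq_of_agree hωs hsA fun i hi => ?_
    have hi' : i ≤ 10 := by omega
    rw [site_two_eq_iff]
    simp only [Ten.aw, Tab.walk_apply_of_le hi', Arm.pt_apply_zero, Arm.pt_apply_one]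
    interval_cases i <;> simp only [h00, h01, hX1', hY1, hX2, hY2, hX3, hY3, hX4, hY4, hX5, hY5, hX6, hY6, hX7, hY7, hX8', hY8,
      hX9, hY9, hX10', hend10] <;> decide
  · -- the deep branch `(2,−2)`: time 5 is `(3,−2)` (`(1,−2)` is boxed in), time 6 is `(4,−2)`, time 7 is `(4,−1)` (up), then
    -- time 8 is `(5,−1)` (terrace) or `(3,−1)` (right hook)
    have hp6 := hpos 6 (by omega) (by omega)
    have h5 : ω 5 0 = 3 ∧ ω 5 1 = -2 := by
      have a : ω 5 1 = -2 ∧ (ω 5 0 = 3 ∨ ω 5 0 = 1) := by clear s5 s6 h64 h75 hX78 h86 hp6; constructor <;> omega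
      obtain ⟨b, c⟩ := a
      rcases c with c | c
      · exact ⟨c, b⟩
      · exfalso
        have hY6 : ω 6 1 = -3 := by clear s4 s6 h53 h75 hX78 h86; omega
        clear s4 s5 h53 h64 h75 hX78 h86 hp6
        omega
    clear s4 h53 hp6
    obtain ⟨hX5, hY5⟩ := h5
    have h6 : ω 6 0 = 4 ∧ ω 6 1 = -2 := by
      have a : (ω 6 0 = 4 ∧ ω 6 1 = -2) ∨ (ω 6 0 = 3 ∧ ω 6 1 = -3) := by clear s6 h75 hX78 h86; omega
      rcases a with a | ⟨b, c⟩
      · exact a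
      · exfalso; clear s5 h64 h75 hX78 h86; omega
    clear s5 h64
    obtain ⟨hX6, hY6⟩ := h6
    have hX7 : ω 7 0 = 4 := by clear hX78 h86 h75; omega
    clear s6 h75
    have hX8' : ω 8 0 = 5 ∨ ω 8 0 = 3 := by omega
    right
    rcases hX8' with hX8' | hX8'
    · -- the terrace
      have hX9 : ω 9 0 = 5 := by omega
      have hX10' : ω 10 0 = 6 := by omega
      left
      refine Arm.eq_of_agree hωs hsB fun i hi => ?_
      have hi' : i ≤ 10 := by omega
      rw [site_two_eq_iff]
      simp only [Ten.bw, Tab.walk_apply_of_le hi', Arm.pt_apply_zero, Arm.pt_apply_one]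
      interval_cases i <;> simp only [h00, h01, hX1', hY1, hX2, hY2, hX3, hY3, hX4, hY4, hX5, hY5, hX6, hY6, hX7, hY7, hX8', hY8,
        hX9, hY9, hX10', hend10] <;> decide
    · -- the right hook
      have hX9 : ω 9 0 = 3 := by omega
      have hX10' : ω 10 0 = 4 := by omega
      right
      refine Arm.eq_of_agree hωs hsC fun i hi => ?_
      have hi' : i ≤ 10 := by omega
      rw [site_two_eq_iff]
      simp only [Ten.cw, Tab.walk_apply_of_le hi', Arm.pt_apply_zero, Arm.pt_apply_one]
      interval_cases i <;> simp only [h00, h01, hX1', hY1, hX2, hY2, hX3, hY3, hX4, hY4, hX5, hY5, hX6, hY6, hX7, hY7, hX8', hY8,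
        hX9, hY9, hX10', hend10] <;> decide

/-! ### §3  `N₅₁ = 3`, `Λ₁₀(y) = 3y`, `f₅(y) = 3y/β(y)¹⁰` -/

open Classical in
/-- ★★ **At most three** one-visit positive wall bridges of length ten (symbolic length). [cite: JansevanRensburg2000, Section 3.3.2, Lemma 3.20] [cite: EntingJensen2009, Section 7.4.2, Fig. 7.10] -/
theorem card_oneVisit_pwb_ten_le_three {m : ℕ} (hm : m = 10) : #((pwb m).filter fun ω => visits m ω = 1) ≤ 3 := by
  have hsub : ((pwb m).filter fun ω => visits m ω = 1) ⊆ ({Ten.aw, Ten.bw, Ten.cw} : Finset (ℕ → Site 2)) := by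
    intro ω hω
    obtain ⟨hωp, hv⟩ := Finset.mem_filter.1 hω
    simp only [Finset.mem_insert, Finset.mem_singleton]
    exact one_visit_pwb_ten_eq hm hωp hv
  exact (Finset.card_le_card hsub).trans Finset.card_le_three

open Classical in
/-- ★★ `#(ipwb 10) ≤ 3`: an irreducible positive wall bridge of length ten has one visit («THIRD-EXACT»'s order-three census), so it
is one of the three seeds (symbolic length). [cite: MadrasSlade1993, Section 4.2, Definition 4.2.1, (4.2.2)] [cite: JansevanRensburg2000, Section 3.3.2, Lemma 3.20] -/
theorem card_ipwb_ten_le_three {m : ℕ} (hm : m = 10) : #(ipwb m) ≤ 3 :=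
  (Finset.card_le_card fun _ hω => Finset.mem_filter.2 ⟨ipwb_subset hω, visits_eq_one_of_mem_ipwb_ten hm hω⟩).trans
    (card_oneVisit_pwb_ten_le_three hm)

/-- ★★★ **`N₅₁ = #(ipwb 10) = 3`**: the long flat excursion, the terrace and the right hook are THE renewal blocks of length ten
(symbolic length). [cite: MadrasSlade1993, Section 4.2, Definition 4.2.1, (4.2.2)] [cite: Kesten1963SAW, Section 4] [cite: EntingJensen2009, Section 7.4.2, Fig. 7.10] -/
theorem card_ipwb_ten_eq_three {m : ℕ} (hm : m = 10) : #(ipwb m) = 3 :=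
  le_antisymm (card_ipwb_ten_le_three hm) (three_le_card_ipwb_ten hm)

open Classical in
/-- `#{ω ∈ pwb 10 | one visit} = 3` (symbolic length). [cite: JansevanRensburg2000, Section 3.3.2, Lemma 3.20] [cite: EntingJensen2009, Section 7.4.2, Fig. 7.10] -/
theorem card_oneVisit_pwb_ten_eq_three {m : ℕ} (hm : m = 10) : #((pwb m).filter fun ω => visits m ω = 1) = 3 := by
  refine le_antisymm (card_oneVisit_pwb_ten_le_three hm) ?_
  have h3 : 3 ≤ #(ipwb m) := three_le_card_ipwb_ten hm
  exact h3.trans (Finset.card_le_card fun _ hω =>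
    Finset.mem_filter.2 ⟨ipwb_subset hω, visits_eq_one_of_mem_ipwb_ten hm hω⟩)

/-- ★★ **`Λ₁₀(y) = 3y`** (symbolic length). [cite: MadrasSlade1993, Section 4.2, (4.2.2) (p. 91)] -/
theorem IPWB_ten_eq {m : ℕ} (hm : m = 10) (y : ℝ) : IPWB m y = 3 * y := by
  rw [IPWB_ten hm, card_ipwb_ten_eq_three hm]
  norm_num

/-- ★★ **`f₅(y) = 3y/β(y)¹⁰`**: with `f₁ = y/β²`, `f₂ = 0`, `f₃ = y/β⁶`, `f₄ = y/β⁸` the renewal law is explicit through half-length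
five. [cite: MadrasSlade1993, Section 4.2, (4.2.2), (4.2.4) (p. 91)] [cite: Kesten1963SAW, Section 4] -/
theorem pwbLaw_five_eq (y : ℝ) : pwbLaw y 5 = 3 * y / wallRate y ^ 10 := by
  have key : ∀ m, m = 10 → pwbLaw y 5 = 3 * y / wallRate y ^ 10 := by
    intro m hm
    rw [pwbLaw_five hm, card_ipwb_ten_eq_three hm]
    norm_num
  exact key 10 rfl

/-! ### §4  The fourth order of the renewal mean from below -/

/-- ★★ **`12y/β(y)¹⁰ ≤ m(y) − 1 − 2y/β(y)⁶ − 3y/β(y)⁸`** (`y > μ⁴`): in the excess decomposition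
`m − 1 = 2f₃ + 3f₄ + 4f₅ + 5f₆ + 6f₇ + Σ_{j ≥ 0}(j+7) f_{j+8}` every term is nonnegative and `f₃ = y/β⁶`, `f₄ = y/β⁸`, `f₅ = 3y/β¹⁰`.
[cite: MadrasSlade1993, Section 4.2, (4.2.4)–(4.2.5) and Theorem 4.2.2 (pp. 91–92)] [cite: Feller1968, XIII.3] -/
theorem twelve_mul_div_le (hy : hexConnectiveConstant ^ 4 < y) :
    12 * y / wallRate y ^ 10 ≤ pwbMean y - 1 - 2 * y / wallRate y ^ 6 - 3 * y / wallRate y ^ 8 := by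
  have hy0 : 0 ≤ y := (lt_of_le_of_lt (by positivity) hy).le
  have hnn : 0 ≤ pwbMean y - 1 - (2 * pwbLaw y 3 + 3 * pwbLaw y 4 + 4 * pwbLaw y 5 + 5 * pwbLaw y 6 + 6 * pwbLaw y 7) :=
    (hasSum_excess_tail_eight hy).nonneg fun j => mul_nonneg (by positivity) (pwbLaw_nonneg hy0 _)
  have h6 := pwbLaw_nonneg hy0 6
  have h7 := pwbLaw_nonneg hy0 7
  rw [pwbLaw_three y, pwbLaw_four_eq y, pwbLaw_five_eq y] at hnn
  have e1 : 2 * y / wallRate y ^ 6 = 2 * (y / wallRate y ^ 6) := by ring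
  have e2 : 3 * y / wallRate y ^ 8 = 3 * (y / wallRate y ^ 8) := by ring
  have e3 : 12 * y / wallRate y ^ 10 = 4 * (3 * y / wallRate y ^ 10) := by ring
  rw [e1, e2, e3]
  linarith

/-- `12·(y⁵/β¹⁰) ≤ y⁴ (m(y) − 1 − 2y/β⁶ − 3y/β⁸)` (`y > μ⁴`). [cite: MadrasSlade1993, Section 4.2, (4.2.5) (p. 91)] -/
theorem twelve_mul_le_pow_four_mul (hy : hexConnectiveConstant ^ 4 < y) :
    12 * (y ^ 5 / wallRate y ^ 10) ≤ y ^ 4 * (pwbMean y - 1 - 2 * y / wallRate y ^ 6 - 3 * y / wallRate y ^ 8) := by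
  have hy0 : 0 < y := lt_of_le_of_lt (by positivity) hy
  have h := twelve_mul_div_le hy
  have e1 : 12 * (y ^ 5 / wallRate y ^ 10) = y ^ 4 * (12 * y / wallRate y ^ 10) := by ring
  rw [e1]
  exact mul_le_mul_of_nonneg_left h (pow_pos hy0 4).le

/-- `y⁵/β(y)¹⁰ → 1` (`β ∼ √y`). [cite: BeatonBousquetMelouDeGierDuminilCopinGuttmann2014, Section 3.1, Proposition 5 (arXiv v5 p. 9)] -/
theorem tendsto_pow_five_div_wallRate_pow_ten : Tendsto (fun y : ℝ => y ^ 5 / wallRate y ^ 10) atTop (𝓝 1) := by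
  have h1 : Tendsto (fun y : ℝ => ((wallRate y / Real.sqrt y) ^ 10)⁻¹) atTop (𝓝 ((1 : ℝ) ^ 10)⁻¹) :=
    (tendsto_wallRate_div_sqrt.pow 10).inv₀ (by norm_num)
  rw [one_pow, inv_one] at h1
  refine h1.congr' ?_
  filter_upwards [eventually_gt_atTop (0 : ℝ)] with y hy
  have hs : Real.sqrt y ^ 10 = y ^ 5 := by
    rw [show (10 : ℕ) = 2 * 5 by norm_num, pow_mul, Real.sq_sqrt hy.le]
  rw [div_pow, hs, inv_div]

/-- ★★ **`liminf_{y→∞} y⁴ (m(y) − 1 − 2y/β(y)⁶ − 3y/β(y)⁸) ≥ 12`**, as an eventual inequality: for every `ε > 0`, eventually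
`12 − ε ≤ y⁴ (m(y) − 1 − 2y/β⁶ − 3y/β⁸)` (the three blocks of length ten; the conjectured limit is `12 + 5·N₆₂ = 17`, not claimed).
[cite: MadrasSlade1993, Section 4.2, (4.2.5) (p. 91)] [cite: JansevanRensburg2000, Section 3.3.2, Lemma 3.20] -/
theorem eventually_le_pow_four_mul_pwbMean {ε : ℝ} (hε : 0 < ε) :
    ∀ᶠ y : ℝ in atTop, 12 - ε ≤ y ^ 4 * (pwbMean y - 1 - 2 * y / wallRate y ^ 6 - 3 * y / wallRate y ^ 8) := by
  have h1 : ∀ᶠ y : ℝ in atTop, 1 - ε / 12 < y ^ 5 / wallRate y ^ 10 :=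
    tendsto_pow_five_div_wallRate_pow_ten.eventually (eventually_gt_nhds (by linarith))
  filter_upwards [h1, eventually_gt_atTop (hexConnectiveConstant ^ 4)] with y hy1 hy2
  have h3 := twelve_mul_le_pow_four_mul hy2
  linarith

/-- ★ If the fourth-order limit `L = lim y⁴ (m(y) − 1 − 2y/β⁶ − 3y/β⁸)` exists, then `12 ≤ L`. [cite: MadrasSlade1993, Section 4.2, (4.2.5) (p. 91)] -/
theorem twelve_le_of_tendsto_pow_four_mul {L : ℝ}
    (hL : Tendsto (fun y : ℝ => y ^ 4 * (pwbMean y - 1 - 2 * y / wallRate y ^ 6 - 3 * y / wallRate y ^ 8)) atTop (𝓝 L)) :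
    12 ≤ L := by
  have h12 : Tendsto (fun y : ℝ => 12 * (y ^ 5 / wallRate y ^ 10)) atTop (𝓝 12) := by
    simpa using tendsto_pow_five_div_wallRate_pow_ten.const_mul 12
  refine le_of_tendsto_of_tendsto h12 hL ?_
  filter_upwards [eventually_gt_atTop (hexConnectiveConstant ^ 4)] with y hy
  exact twelve_mul_le_pow_four_mul hy

end Literature.Probability.RandomPlanarGeometry.SAW.HexBW.Wall
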